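import Literature.Analysis.FluidPDE.CaloricDuhamelRepresentation
import Literature.Analysis.FluidPDE.CKNStep3KernelBounds
import HarnessLib

/-!
# The caloric test fields of the duality proof of Lemma 13.5: potential bounds for every viscosity

Analysis/FluidPDE support file (everything proved) for the discharge of the named fact
`Literature.Analysis.FluidPDE.LemarieRieusset2016.lemma13_5_step` (`CKNMorreyBootstrap.lean`;
Lemarié-Rieusset 2016, proof of Lemma 13.5, pp. 475–477). The printed proof represents the
localised velocity `v = φu` through the heat kernel ((13.50)–(13.52)) and bounds it by parabolic
Riesz potentials of the data. The tree proves such representations *by duality*: the equations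
are tested against cut-offs of the backward caloric Duhamel integrals
`𝒰_ν[Θ](s, x) = ∫_{σ>0} e^{νσΔ}Θ(s + σ)(x) dσ` (`HeatDuhamelBack.lean`) of a space–time test
function `g` and of `∂_c N[g]`, `N = Γ₀ ⋆` the truncated Newtonian potential
(`CaloricDuhamelRepresentation.lean`, written there for `ν = 1`). This file supplies, for **every
viscosity `ν > 0`**, the pointwise bounds on these fields that the Morrey estimate consumes:

* `timeDeriv_add_mul_laplacian_heatDuhamelBack` — the backward heat equation
  `∂ₛ𝒰_ν[Θ] + νΔ𝒰_ν[Θ] = -Θ`, and `laplacian_heatDuhamelBack_fderiv_newtonNearPotential_nu` —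
  `Δ 𝒰_ν[∂_cN g] = ∂_c 𝒰_ν[g] - 𝒰_ν[Λ ∂_c g]` (`ΔN = 1 - Λ`);
* `enorm_heatDuhamelBack_le_lintegral` — **the potentials are dominated by their kernels**: if
  the slices obey `‖e^{aΔ}Θ'(t)(y)‖ ≤ ∫ |κ_a(x')| |g(t, y - x')| dx'`, then
  `‖𝒰_ν[Θ'](s, y)‖ ≤ ∫∫_{t>s} |κ_{ν(t-s)}(y - x)| |g(t, x)| dt dx` (Tonelli only — no convergence
  issue, the bound being an inequality of lower Lebesgue integrals);
* the slice bounds for `𝒰_ν[g]` (heat kernel), `∂ᵥ𝒰_ν[g]` (its gradient), `Ξ = 𝒰_ν[∂_cN g]`,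
  `∂ᵥΞ`, `∂ᵤ∂ᵥΞ` (`heatD1/2/3 · Γ₀`) and `𝒰_ν[Λ ∂_c g]` (`heatD1 · λ`);
* **parabolic conclusions**: on a region where the data lie at bounded parabolic distance,
  `‖𝒰_ν[g](s,y)‖ ≤ C ∫∫ δ₂^{-3} |g|`, `‖∂ᵥ𝒰_ν[g](s,y)‖ ≤ C ∫∫ δ₂^{-4} |g|`,
  `‖∂ᵤ∂ᵥΞ(s,y)‖ ≤ C ∫∫ δ₂^{-4} |g|` (the kernels of `𝓘₂`, `𝓘₁`; Lemarié-Rieusset 2016,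
  (13.52) and p. 465), from the kernel bounds of `CKNStep3KernelBounds.lean`; and **off-diagonal
  conclusions**: where the data are parabolically separated from `(s, y)`, each of
  `𝒰_ν[g]`, `∂ᵥ𝒰_ν[g]`, `Ξ`, `∂ᵥΞ` is bounded by `C ‖g‖_{L¹}`, while `𝒰_ν[Λ ∂_c g]` is so
  everywhere.

## References

* P. G. Lemarié-Rieusset, *The Navier–Stokes Problem in the 21st Century*, CRC Press (2016),
  Prop. 4.3 p. 74 (Duhamel integrals), p. 465 (kernel sizes), (13.50)–(13.52) pp. 474–475.
  [LemarieRieusset2016]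
-/

noncomputable section

open MeasureTheory Set Function Filter Metric Real ContinuousLinearMap TopologicalSpace
open scoped ENNReal NNReal Topology RealInnerProductSpace Convolution Laplacian

namespace Literature.Analysis.FluidPDE

section General

variable {E : Type*} [NormedAddCommGroup E] [InnerProductSpace ℝ E] [FiniteDimensional ℝ E]
  [MeasurableSpace E] [BorelSpace E]
variable {ν : ℝ}

/-! ### Two more kernel bounds: the Hessian layer away from the initial time, off-diagonal forms -/

/-- **`heatD2 a v c φ` is bounded uniformly for `a ≥ ε`** (`φ ∈ L¹`): from
`heatD2 a v c φ (x) = ∫ ∂ᵥ∂_cG_a(x - y) φ(y) dy` and the Gaussian bound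
`|∂ᵥ∂_cG_a(z)| ≤ C ‖v‖ ‖c‖ (a + ‖z‖²)^{-(d+2)/2} ≤ C ‖v‖ ‖c‖ ε^{-(d+2)/2}`. [folklore] -/
theorem exists_abs_heatD2_le_of_le_time {φ : E → ℝ} (hφ : Integrable φ volume) (v c : E) {ε : ℝ}
    (hε : 0 < ε) :
    ∃ B : ℝ, 0 ≤ B ∧ ∀ {a : ℝ}, ε ≤ a → ∀ x : E, |heatD2 a v c φ x| ≤ B := by
  obtain ⟨C, hC, hW⟩ := exists_abs_heatKernelHessWeight_le (E := E)
  set K : ℝ := C * ‖v‖ * ‖c‖ * ε ^ (-(((Module.finrank ℝ E : ℝ) + 2) / 2)) with hK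
  have hK0 : 0 ≤ K := by rw [hK]; positivity
  refine ⟨K * ∫ y, |φ y|, by positivity, fun {a} ha x => ?_⟩
  have ha0 : 0 < a := hε.trans_le ha
  rw [heatD2_eq_integral_heatKernelHessWeight ((memLp_one_iff_integrable).2 hφ) le_rfl ha0 v c x]
  have hpt : ∀ y, |heatKernelHessWeight a v c (x - y) * φ y| ≤ K * |φ y| := by
    intro y
    rw [abs_mul]
    refine mul_le_mul_of_nonneg_right ((hW ha0 v c (x - y)).trans ?_) (abs_nonneg _)
    rw [hK]
    refine mul_le_mul_of_nonneg_left ?_ (by positivity)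
    have hd : 0 ≤ ((Module.finrank ℝ E : ℝ) + 2) / 2 := by positivity
    exact Real.rpow_le_rpow_of_nonpos hε (by nlinarith [norm_nonneg (x - y)]) (neg_nonpos.2 hd)
  have hint : Integrable (fun y => K * |φ y|) volume := hφ.abs.const_mul K
  calc |∫ y, heatKernelHessWeight a v c (x - y) * φ y|
      ≤ ∫ y, |heatKernelHessWeight a v c (x - y) * φ y| := abs_integral_le_integral_abs
    _ ≤ ∫ y, K * |φ y| :=
        integral_mono_of_nonneg (Eventually.of_forall fun y => abs_nonneg _) hint
          (Eventually.of_forall hpt)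
    _ = K * ∫ y, |φ y| := integral_const_mul _ _

omit [InnerProductSpace ℝ E] [FiniteDimensional ℝ E] [MeasurableSpace E] [BorelSpace E] in
/-- **Off-diagonal bound for a negative power of the parabolic weight**: on
`{a ≥ a₀} ∪ {‖x‖ ≥ d₀}`, `(a + ‖x‖²)^{-e} ≤ (min a₀ d₀²)^{-e}` (`e ≥ 0`, `a > 0`). [folklore] -/
theorem add_sq_rpow_neg_le_offDiag {a₀ d₀ e a : ℝ} (ha₀ : 0 < a₀) (hd₀ : 0 < d₀) (he : 0 ≤ e)
    (ha : 0 < a) (x : E) (hx : a₀ ≤ a ∨ d₀ ≤ ‖x‖) :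
    (a + ‖x‖ ^ 2) ^ (-e) ≤ (min a₀ (d₀ ^ 2)) ^ (-e) := by
  have hm : 0 < min a₀ (d₀ ^ 2) := lt_min ha₀ (by positivity)
  refine Real.rpow_le_rpow_of_nonpos hm ?_ (neg_nonpos.2 he)
  rcases hx with h | h
  · exact (min_le_left _ _).trans (by nlinarith [norm_nonneg x])
  · have : d₀ ^ 2 ≤ ‖x‖ ^ 2 := pow_le_pow_left₀ hd₀.le h 2
    exact (min_le_right _ _).trans (by linarith)

/-! ### The backward heat equation for every viscosity -/

/-- **`∂ₛ𝒰_ν[Θ] + ν Δ𝒰_ν[Θ] = -Θ`** for a scalar space–time test function `Θ` (the tree's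
`heatDuhamelBack_backward_heat`, `deriv_heatDuhamelBack_time`, `laplacian_heatDuhamelBack`).
[cite: LemarieRieusset2016, Prop. 4.3 (B) p. 74] -/
theorem timeDeriv_add_mul_laplacian_heatDuhamelBack {Θ : ℝ → E → ℝ}
    (hΘ : IsSpaceTimeTestOn (⊤ : Opens (ℝ × E)) Θ) (hν : 0 < ν) (s : ℝ) (x : E) :
    timeDeriv (heatDuhamelBack ν Θ) s x + ν * (Δ (heatDuhamelBack ν Θ s)) x = -Θ s x := by
  rw [timeDeriv_apply, hΘ.deriv_heatDuhamelBack_time hν s x, hΘ.laplacian_heatDuhamelBack hν s x]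
  have h := hΘ.heatDuhamelBack_backward_heat hν s x
  rwa [smul_eq_mul] at h

/-! ### Potentials are dominated by their kernels -/

/-- **Domination of a backward Duhamel integral by its kernel** (Tonelli): let `Θ'`, `g` be
continuous space–time fields and `κ : ℝ → E → ℝ` a family continuous on
`(0, ∞) × E` such that the slices satisfy
`‖e^{aΔ}(Θ'(t))(y)‖ ≤ ∫ |κ a x'| |g t (y - x')| dx'` for all `a > 0`. Then for every `(s, y)`
`‖𝒰_ν[Θ'](s, y)‖ₑ ≤ ∫⁻_{(t,x)} 1_{t>s} |κ (ν(t-s)) (y - x)| ‖g t x‖ₑ`. [folklore] -/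
theorem enorm_heatDuhamelBack_le_lintegral {Θ' g : ℝ → E → ℝ} {κ : ℝ → E → ℝ}
    (hν : 0 < ν)
    (hκ : ContinuousOn (fun q : ℝ × E => κ q.1 q.2) (Ioi 0 ×ˢ univ))
    (hgc : Continuous (uncurry g))
    (hslice : ∀ {a : ℝ}, 0 < a → ∀ t y,
      ‖UnboundedOperators.heatExtension (Θ' t) a y‖ₑ ≤
        ∫⁻ x', ENNReal.ofReal |κ a x'| * ‖g t (y - x')‖ₑ)
    (s : ℝ) (y : E) :
    ‖heatDuhamelBack ν Θ' s y‖ₑ ≤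
      ∫⁻ w : ℝ × E, (Ioi s ×ˢ (univ : Set E)).indicator
        (fun w => ENNReal.ofReal |κ (ν * (w.1 - s)) (y - w.2)| * ‖g w.1 w.2‖ₑ) w := by
  -- the integrand of the right-hand side, and its measurability
  set F : ℝ × E → ℝ≥0∞ := fun w => ENNReal.ofReal |κ (ν * (w.1 - s)) (y - w.2)| * ‖g w.1 w.2‖ₑ
    with hF
  have hS : MeasurableSet (Ioi s ×ˢ (univ : Set E)) := measurableSet_Ioi.prod MeasurableSet.univ
  have hκc : ContinuousOn (fun w : ℝ × E => κ (ν * (w.1 - s)) (y - w.2)) (Ioi s ×ˢ univ) := by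
    have hmap : Continuous fun w : ℝ × E => ((ν * (w.1 - s), y - w.2) : ℝ × E) := by fun_prop
    refine hκ.comp hmap.continuousOn fun w hw => ⟨?_, mem_univ _⟩
    exact mul_pos hν (sub_pos.2 hw.1)
  have hFm : AEMeasurable ((Ioi s ×ˢ (univ : Set E)).indicator F) (volume : Measure (ℝ × E)) := by
    refine (aemeasurable_indicator_iff hS).2 ?_
    have h1 : AEMeasurable (fun w : ℝ × E => ENNReal.ofReal |κ (ν * (w.1 - s)) (y - w.2)|)
        ((volume : Measure (ℝ × E)).restrict (Ioi s ×ˢ univ)) :=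
      (ENNReal.continuous_ofReal.comp_continuousOn (continuous_abs.comp_continuousOn hκc)).aemeasurable hS
    have h2 : AEMeasurable (fun w : ℝ × E => ‖g w.1 w.2‖ₑ)
        ((volume : Measure (ℝ × E)).restrict (Ioi s ×ˢ univ)) :=
      (hgc.measurable.enorm).aemeasurable
    exact h1.mul h2
  -- step 1: the norm of the `σ`-integral and the slice bounds
  rw [heatDuhamelBack_apply]
  refine (enorm_integral_le_lintegral_enorm _).trans ?_
  refine (setLIntegral_mono' measurableSet_Ioi fun σ hσ => hslice (mul_pos hν hσ) (s + σ) y).trans ?_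
  -- step 2: the substitution `x = y - x'` in the slices
  have hinner : ∀ σ : ℝ, ∫⁻ x', ENNReal.ofReal |κ (ν * σ) x'| * ‖g (s + σ) (y - x')‖ₑ =
      ∫⁻ x, ENNReal.ofReal |κ (ν * σ) (y - x)| * ‖g (s + σ) x‖ₑ := by
    intro σ
    have h := lintegral_sub_left_eq_self (μ := (volume : Measure E))
      (fun x => ENNReal.ofReal |κ (ν * σ) (y - x)| * ‖g (s + σ) x‖ₑ) y
    simp only [sub_sub_cancel] at h
    exact h
  simp_rw [hinner]
  -- step 3: the substitution `t = s + σ` in time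
  have htime : ∫⁻ σ in Ioi (0 : ℝ), ∫⁻ x, ENNReal.ofReal |κ (ν * σ) (y - x)| * ‖g (s + σ) x‖ₑ =
      ∫⁻ t in Ioi s, ∫⁻ x, ENNReal.ofReal |κ (ν * (t - s)) (y - x)| * ‖g t x‖ₑ := by
    set Φ : ℝ → ℝ≥0∞ := fun t => ∫⁻ x, ENNReal.ofReal |κ (ν * (t - s)) (y - x)| * ‖g t x‖ₑ with hΦ
    have h1 : ∀ σ : ℝ, (∫⁻ x, ENNReal.ofReal |κ (ν * σ) (y - x)| * ‖g (s + σ) x‖ₑ) = Φ (σ + s) := by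
      intro σ
      show _ = ∫⁻ x, ENNReal.ofReal |κ (ν * (σ + s - s)) (y - x)| * ‖g (σ + s) x‖ₑ
      rw [add_sub_cancel_right, add_comm σ s]
    simp_rw [h1]
    rw [← lintegral_indicator measurableSet_Ioi, ← lintegral_indicator measurableSet_Ioi]
    have h2 : (fun σ : ℝ => (Ioi (0 : ℝ)).indicator (fun σ => Φ (σ + s)) σ) =
        fun σ => (Ioi s).indicator Φ (σ + s) := by
      funext σ
      by_cases hσ : σ ∈ Ioi (0 : ℝ)
      · rw [indicator_of_mem hσ, indicator_of_mem (show σ + s ∈ Ioi s by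
          rw [mem_Ioi] at hσ ⊢; linarith)]
      · rw [indicator_of_notMem hσ, indicator_of_notMem (fun h => hσ (by
          rw [mem_Ioi] at h ⊢; linarith))]
    rw [h2]
    exact lintegral_add_right_eq_self ((Ioi s).indicator Φ) s
  rw [htime]
  -- step 4: Tonelli
  refine le_of_eq ?_
  rw [Measure.volume_eq_prod, lintegral_prod _ (by rwa [← Measure.volume_eq_prod]),
    ← lintegral_indicator measurableSet_Ioi]
  refine lintegral_congr fun t => ?_
  by_cases ht : t ∈ Ioi s
  · rw [indicator_of_mem ht]
    refine lintegral_congr fun x => ?_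
    rw [indicator_of_mem (show (t, x) ∈ Ioi s ×ˢ (univ : Set E) from ⟨ht, mem_univ _⟩)]
  · rw [indicator_of_notMem ht]
    have h0 : ∀ x : E, (Ioi s ×ˢ (univ : Set E)).indicator F (t, x) = 0 := fun x =>
      indicator_of_notMem (fun h : (t, x) ∈ Ioi s ×ˢ (univ : Set E) => ht h.1) _
    simp only [h0, lintegral_zero]

/-- **Parabolic form of the kernel domination.** In the situation of
`enorm_heatDuhamelBack_le_lintegral`, suppose the kernel obeys the Gaussian-type bound
`|κ a x'| ≤ C (a + ‖x'‖²)^{-e}` whenever `a > 0` and `P a x'` (`e > 0`), and that the data seen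
from `(s, y)` lie in that range: `g t x ≠ 0`, `t > s` imply `P (ν(t - s)) (y - x)`. Then
`‖𝒰_ν[Θ'](s, y)‖ₑ ≤ C (min ν 1 / 2)^{-e} ∫⁻ δ₂((s,y),(t,x))^{-2e} ‖g t x‖ₑ`, the parabolic
Riesz kernel of order `5 - 2e` (Lemarié-Rieusset 2016, Thm. 5.3 and (13.52)). [folklore] -/
theorem enorm_heatDuhamelBack_le_parabolic {Θ' g : ℝ → (EuclideanSpace ℝ (Fin 3)) → ℝ}
    {κ : ℝ → (EuclideanSpace ℝ (Fin 3)) → ℝ} (hν : 0 < ν)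
    (hκ : ContinuousOn (fun q : ℝ × EuclideanSpace ℝ (Fin 3) => κ q.1 q.2) (Ioi 0 ×ˢ univ))
    (hgc : Continuous (uncurry g))
    (hslice : ∀ {a : ℝ}, 0 < a → ∀ t y,
      ‖UnboundedOperators.heatExtension (Θ' t) a y‖ₑ ≤
        ∫⁻ x', ENNReal.ofReal |κ a x'| * ‖g t (y - x')‖ₑ)
    {P : ℝ → EuclideanSpace ℝ (Fin 3) → Prop} {C e : ℝ} (hC : 0 ≤ C) (he : 0 < e)
    (hbound : ∀ {a : ℝ}, 0 < a → ∀ x' : EuclideanSpace ℝ (Fin 3), P a x' →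
      |κ a x'| ≤ C * (a + ‖x'‖ ^ 2) ^ (-e))
    {s : ℝ} {y : EuclideanSpace ℝ (Fin 3)}
    (hrange : ∀ t x, g t x ≠ 0 → s < t → P (ν * (t - s)) (y - x)) :
    ‖heatDuhamelBack ν Θ' s y‖ₑ ≤
      ENNReal.ofReal (C * (min ν 1 / 2) ^ (-e)) *
        ∫⁻ w : ℝ × EuclideanSpace ℝ (Fin 3),
          (ENNReal.ofReal (parabolicDist (s, y) w) ^ (2 * e))⁻¹ * ‖g w.1 w.2‖ₑ := by
  refine (enorm_heatDuhamelBack_le_lintegral hν hκ hgc hslice s y).trans ?_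
  rw [← lintegral_const_mul' _ _ ENNReal.ofReal_ne_top]
  refine lintegral_mono fun w => ?_
  by_cases hw : w ∈ Ioi s ×ˢ (univ : Set (EuclideanSpace ℝ (Fin 3)))
  · rw [indicator_of_mem hw]
    by_cases hg0 : g w.1 w.2 = 0
    · simp [hg0]
    · have hst : s < w.1 := hw.1
      have hP := hrange w.1 w.2 hg0 hst
      have ha : 0 < ν * (w.1 - s) := mul_pos hν (sub_pos.2 hst)
      rw [← mul_assoc]
      refine mul_le_mul' ?_ le_rfl
      have h1 := hbound ha (y - w.2) hP
      have h2 := ofReal_add_sq_rpow_neg_le_parabolicKernel hν hst w.2 y he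
      rw [norm_sub_rev w.2 y, show ((w.1, w.2) : ℝ × EuclideanSpace ℝ (Fin 3)) = w from rfl,
        parabolicDist_comm w (s, y)] at h2
      calc ENNReal.ofReal |κ (ν * (w.1 - s)) (y - w.2)|
          ≤ ENNReal.ofReal (C * (ν * (w.1 - s) + ‖y - w.2‖ ^ 2) ^ (-e)) := ENNReal.ofReal_le_ofReal h1
        _ = ENNReal.ofReal C * ENNReal.ofReal ((ν * (w.1 - s) + ‖y - w.2‖ ^ 2) ^ (-e)) :=
            ENNReal.ofReal_mul hC
        _ ≤ ENNReal.ofReal C * (ENNReal.ofReal ((min ν 1 / 2) ^ (-e)) *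
              (ENNReal.ofReal (parabolicDist (s, y) w) ^ (2 * e))⁻¹) := mul_le_mul' le_rfl h2
        _ = ENNReal.ofReal (C * (min ν 1 / 2) ^ (-e)) *
              (ENNReal.ofReal (parabolicDist (s, y) w) ^ (2 * e))⁻¹ := by
            rw [ENNReal.ofReal_mul hC, mul_assoc]
  · rw [indicator_of_notMem hw]
    exact zero_le

/-- **Off-diagonal form of the kernel domination.** In the situation of
`enorm_heatDuhamelBack_le_lintegral`, suppose `|κ a x'| ≤ B` whenever `a > 0` and `P a x'`, and
that the data seen from `(s, y)` lie in that range: `g t x ≠ 0`, `t > s` imply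
`P (ν(t - s)) (y - x)`. Then `‖𝒰_ν[Θ'](s, y)‖ₑ ≤ B ∫⁻ ‖g‖ₑ`. [folklore] -/
theorem enorm_heatDuhamelBack_le_offDiag {Θ' g : ℝ → E → ℝ} {κ : ℝ → E → ℝ}
    (hν : 0 < ν)
    (hκ : ContinuousOn (fun q : ℝ × E => κ q.1 q.2) (Ioi 0 ×ˢ univ))
    (hgc : Continuous (uncurry g))
    (hslice : ∀ {a : ℝ}, 0 < a → ∀ t y,
      ‖UnboundedOperators.heatExtension (Θ' t) a y‖ₑ ≤
        ∫⁻ x', ENNReal.ofReal |κ a x'| * ‖g t (y - x')‖ₑ)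
    {P : ℝ → E → Prop} {B : ℝ}
    (hbound : ∀ {a : ℝ}, 0 < a → ∀ x' : E, P a x' → |κ a x'| ≤ B)
    {s : ℝ} {y : E} (hrange : ∀ t x, g t x ≠ 0 → s < t → P (ν * (t - s)) (y - x)) :
    ‖heatDuhamelBack ν Θ' s y‖ₑ ≤
      ENNReal.ofReal B * ∫⁻ w : ℝ × E, ‖g w.1 w.2‖ₑ := by
  refine (enorm_heatDuhamelBack_le_lintegral hν hκ hgc hslice s y).trans ?_
  rw [← lintegral_const_mul' _ _ ENNReal.ofReal_ne_top]
  refine lintegral_mono fun w => ?_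
  by_cases hw : w ∈ Ioi s ×ˢ (univ : Set E)
  · rw [indicator_of_mem hw]
    by_cases hg0 : g w.1 w.2 = 0
    · simp [hg0]
    · have hst : s < w.1 := hw.1
      refine mul_le_mul' (ENNReal.ofReal_le_ofReal ?_) le_rfl
      exact hbound (mul_pos hν (sub_pos.2 hst)) _ (hrange w.1 w.2 hg0 hst)
  · rw [indicator_of_notMem hw]
    exact zero_le

/-! ### The slice bounds for `𝒰_ν[g]` and its gradient -/

/-- Slice bound for the field itself: `‖e^{aΔ}h(y)‖ₑ ≤ ∫⁻ G_a(x') ‖h(y - x')‖ₑ`. [folklore] -/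
theorem enorm_heatExtension_le_lintegral_heatKernel (h : E → ℝ) (a : ℝ) (y : E) :
    ‖UnboundedOperators.heatExtension h a y‖ₑ ≤
      ∫⁻ x', ENNReal.ofReal |UnboundedOperators.heatKernel a x'| * ‖h (y - x')‖ₑ := by
  rw [UnboundedOperators.heatExtension_apply]
  refine (enorm_integral_le_lintegral_enorm _).trans (lintegral_mono fun x' => ?_)
  rw [enorm_smul, Real.enorm_eq_ofReal_abs]

/-- Slice bound for the gradient: `‖e^{aΔ}(∂ᵥh)(y)‖ₑ ≤ ∫⁻ |∂ᵥG_a(x')| ‖h(y - x')‖ₑ` for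
`h ∈ C_c^∞`. [folklore] -/
theorem enorm_heatExtension_fderiv_le_lintegral_heatKernelGrad {h : E → ℝ}
    (hh : ContDiff ℝ ((⊤ : ℕ∞) : WithTop ℕ∞) h) (hhc : HasCompactSupport h) {a : ℝ} (ha : 0 < a)
    (v y : E) :
    ‖UnboundedOperators.heatExtension (fun x => fderiv ℝ h x v) a y‖ₑ ≤
      ∫⁻ x', ENNReal.ofReal |heatKernelGrad v a x'| * ‖h (y - x')‖ₑ := by
  rw [heatExtension_fderiv_apply_eq_integral_heatKernelGrad hh hhc ha v y]
  refine (enorm_integral_le_lintegral_enorm _).trans (lintegral_mono fun x' => ?_)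
  rw [enorm_mul, Real.enorm_eq_ofReal_abs]

variable {g : ℝ → E → ℝ}

/-- **`𝒰_ν[g]` is dominated by the backward heat kernel**:
`‖𝒰_ν[g](s,y)‖ₑ ≤ ∫⁻ 1_{t>s} G_{ν(t-s)}(y - x) ‖g t x‖ₑ`. [folklore] -/
theorem enorm_heatDuhamelBack_le_lintegral_heatKernel
    (hg : IsSpaceTimeTestOn (⊤ : Opens (ℝ × E)) g) (hν : 0 < ν) (s : ℝ) (y : E) :
    ‖heatDuhamelBack ν g s y‖ₑ ≤
      ∫⁻ w : ℝ × E, (Ioi s ×ˢ (univ : Set E)).indicator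
        (fun w => ENNReal.ofReal |UnboundedOperators.heatKernel (ν * (w.1 - s)) (y - w.2)| *
          ‖g w.1 w.2‖ₑ) w :=
  enorm_heatDuhamelBack_le_lintegral hν continuousOn_heatKernel_family hg.continuous_uncurry
    (fun _ t y => enorm_heatExtension_le_lintegral_heatKernel (g t) _ y) s y

/-- **`∂ᵥ𝒰_ν[g]` is dominated by the backward heat-gradient kernel**:
`‖∂ᵥ𝒰_ν[g](s,y)‖ₑ ≤ ∫⁻ 1_{t>s} |∂ᵥG_{ν(t-s)}(y - x)| ‖g t x‖ₑ`. [folklore] -/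
theorem enorm_fderiv_heatDuhamelBack_le_lintegral_heatKernelGrad
    (hg : IsSpaceTimeTestOn (⊤ : Opens (ℝ × E)) g) (hν : 0 < ν) (s : ℝ) (y v : E) :
    ‖fderiv ℝ (heatDuhamelBack ν g s) y v‖ₑ ≤
      ∫⁻ w : ℝ × E, (Ioi s ×ˢ (univ : Set E)).indicator
        (fun w => ENNReal.ofReal |heatKernelGrad v (ν * (w.1 - s)) (y - w.2)| * ‖g w.1 w.2‖ₑ) w := by
  rw [hg.fderiv_heatDuhamelBack_apply hν s y v]
  exact enorm_heatDuhamelBack_le_lintegral hν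
    (continuousOn_heatKernelGrad_family v) hg.continuous_uncurry
    (fun ha t y => enorm_heatExtension_fderiv_le_lintegral_heatKernelGrad (hg.contDiff_slice t)
      (hg.hasCompactSupport_slice t) ha v y) s y

end General

/-! ### Dimension three: parabolic and off-diagonal bounds for `𝒰_ν[g]`, `∂ᵥ𝒰_ν[g]` -/

section Heat3

variable {ν : ℝ} {g : ℝ → (EuclideanSpace ℝ (Fin 3)) → ℝ}

/-- **`|𝒰_ν[g](s,y)| ≤ C ∫∫ δ₂^{-3} |g|`** (the kernel of `𝓘₂`; Lemarié-Rieusset 2016, p. 465: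
`|W| ≤ C ρ₂⁻³`): for `ν > 0` and `R > 0` there is `C` such that the bound holds at every `(s, y)`
from which the support of `g` is seen within spatial distance `R` (no constraint in time).
[cite: LemarieRieusset2016, Prop. 13.4 proof p. 465] -/
theorem exists_enorm_heatDuhamelBack_le_parabolic (hν : 0 < ν) :
    ∃ C : ℝ, 0 < C ∧ ∀ {g : ℝ → (EuclideanSpace ℝ (Fin 3)) → ℝ}, IsSpaceTimeTestOn (⊤ : Opens (ℝ × (EuclideanSpace ℝ (Fin 3)))) g →
      ∀ (s : ℝ) (y : (EuclideanSpace ℝ (Fin 3))),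
        ‖heatDuhamelBack ν g s y‖ₑ ≤ ENNReal.ofReal C *
          ∫⁻ w : ℝ × (EuclideanSpace ℝ (Fin 3)), (ENNReal.ofReal (parabolicDist (s, y) w) ^ (3 : ℝ))⁻¹ * ‖g w.1 w.2‖ₑ := by
  obtain ⟨C, hC, hG⟩ := exists_heatKernel_le_add_sq_rpow_dim3
  refine ⟨C * (min ν 1 / 2) ^ (-(3 / 2 : ℝ)), by positivity, fun {g} hg s y => ?_⟩
  have h := enorm_heatDuhamelBack_le_parabolic (P := fun _ _ => True) hν
    continuousOn_heatKernel_family hg.continuous_uncurry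
    (fun _ t y => enorm_heatExtension_le_lintegral_heatKernel (g t) _ y)
    hC.le (by norm_num : (0 : ℝ) < 3 / 2) (C := C) (s := s) (y := y)
    (fun ha x' _ => by
      rw [abs_of_nonneg (UnboundedOperators.heatKernel_pos ha x').le]; exact hG ha x')
    (fun _ _ _ _ => trivial)
  rwa [show (2 * (3 / 2 : ℝ)) = 3 by norm_num] at h

/-- **`|∂ᵥ𝒰_ν[g](s,y)| ≤ C ‖v‖ ∫∫ δ₂^{-4} |g|`** (the kernel of `𝓘₁`; Lemarié-Rieusset 2016,
p. 465: `|∇W| ≤ C ρ₂⁻⁴`), at every `(s, y)`, with `C = C(ν)`.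
[cite: LemarieRieusset2016, Prop. 13.4 proof p. 465] -/
theorem exists_enorm_fderiv_heatDuhamelBack_le_parabolic (hν : 0 < ν) :
    ∃ C : ℝ, 0 < C ∧ ∀ {g : ℝ → (EuclideanSpace ℝ (Fin 3)) → ℝ}, IsSpaceTimeTestOn (⊤ : Opens (ℝ × (EuclideanSpace ℝ (Fin 3)))) g →
      ∀ (s : ℝ) (y v : (EuclideanSpace ℝ (Fin 3))), ‖v‖ ≤ 1 →
        ‖fderiv ℝ (heatDuhamelBack ν g s) y v‖ₑ ≤ ENNReal.ofReal C *
          ∫⁻ w : ℝ × (EuclideanSpace ℝ (Fin 3)), (ENNReal.ofReal (parabolicDist (s, y) w) ^ (4 : ℝ))⁻¹ * ‖g w.1 w.2‖ₑ := by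
  obtain ⟨C, hC, hG⟩ := exists_abs_heatKernelGrad_le_dim3
  refine ⟨C * (min ν 1 / 2) ^ (-(2 : ℝ)), by positivity, fun {g} hg s y v hv => ?_⟩
  rw [hg.fderiv_heatDuhamelBack_apply hν s y v]
  have h := enorm_heatDuhamelBack_le_parabolic (P := fun _ _ => True) hν
    (continuousOn_heatKernelGrad_family v) hg.continuous_uncurry
    (fun ha t y => enorm_heatExtension_fderiv_le_lintegral_heatKernelGrad (hg.contDiff_slice t)
      (hg.hasCompactSupport_slice t) ha v y)
    hC.le (by norm_num : (0 : ℝ) < 2) (C := C) (s := s) (y := y)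
    (fun {a} ha x' _ => by
      calc |heatKernelGrad v a x'| ≤ C * ‖v‖ * (a + ‖x'‖ ^ 2) ^ (-(2 : ℝ)) := hG ha v x'
        _ ≤ C * 1 * (a + ‖x'‖ ^ 2) ^ (-(2 : ℝ)) := by gcongr
        _ = C * (a + ‖x'‖ ^ 2) ^ (-(2 : ℝ)) := by rw [mul_one])
    (fun _ _ _ _ => trivial)
  rwa [show (2 * (2 : ℝ)) = 4 by norm_num] at h

/-- **Off-diagonal bound for `𝒰_ν[g]`**: if from `(s, y)` the support of `g` is only seen at
heat times `ν(t - s) ≥ a₀` or spatial distances `‖y - x‖ ≥ d₀`, then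
`|𝒰_ν[g](s, y)| ≤ B ∫∫ |g|` with `B = B(a₀, d₀)` (the heat kernel is bounded there). [folklore] -/
theorem exists_enorm_heatDuhamelBack_le_offDiag (hν : 0 < ν) {a₀ d₀ : ℝ} (ha₀ : 0 < a₀)
    (hd₀ : 0 < d₀) :
    ∃ B : ℝ, 0 ≤ B ∧ ∀ {g : ℝ → (EuclideanSpace ℝ (Fin 3)) → ℝ}, IsSpaceTimeTestOn (⊤ : Opens (ℝ × (EuclideanSpace ℝ (Fin 3)))) g →
      ∀ (s : ℝ) (y : (EuclideanSpace ℝ (Fin 3))),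
        (∀ t x, g t x ≠ 0 → s < t → a₀ ≤ ν * (t - s) ∨ d₀ ≤ ‖y - x‖) →
        ‖heatDuhamelBack ν g s y‖ₑ ≤ ENNReal.ofReal B * ∫⁻ w : ℝ × (EuclideanSpace ℝ (Fin 3)), ‖g w.1 w.2‖ₑ := by
  obtain ⟨C, hC, hG⟩ := exists_heatKernel_le_add_sq_rpow_dim3
  refine ⟨C * (min a₀ (d₀ ^ 2)) ^ (-(3 / 2 : ℝ)), by positivity, fun {g} hg s y hsee => ?_⟩
  exact enorm_heatDuhamelBack_le_offDiag (P := fun a x' => a₀ ≤ a ∨ d₀ ≤ ‖x'‖) hν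
    continuousOn_heatKernel_family hg.continuous_uncurry
    (fun _ t y => enorm_heatExtension_le_lintegral_heatKernel (g t) _ y)
    (fun ha x' hP => by
      rw [abs_of_nonneg (UnboundedOperators.heatKernel_pos ha x').le]
      exact (hG ha x').trans (mul_le_mul_of_nonneg_left
        (add_sq_rpow_neg_le_offDiag ha₀ hd₀ (by norm_num) ha x' hP) hC.le))
    hsee

/-- **Off-diagonal bound for `∂ᵥ𝒰_ν[g]`** (`‖v‖ ≤ 1`), as `exists_enorm_heatDuhamelBack_le_offDiag`.
[folklore] -/
theorem exists_enorm_fderiv_heatDuhamelBack_le_offDiag (hν : 0 < ν) {a₀ d₀ : ℝ} (ha₀ : 0 < a₀)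
    (hd₀ : 0 < d₀) :
    ∃ B : ℝ, 0 ≤ B ∧ ∀ {g : ℝ → (EuclideanSpace ℝ (Fin 3)) → ℝ}, IsSpaceTimeTestOn (⊤ : Opens (ℝ × (EuclideanSpace ℝ (Fin 3)))) g →
      ∀ (s : ℝ) (y v : (EuclideanSpace ℝ (Fin 3))), ‖v‖ ≤ 1 →
        (∀ t x, g t x ≠ 0 → s < t → a₀ ≤ ν * (t - s) ∨ d₀ ≤ ‖y - x‖) →
        ‖fderiv ℝ (heatDuhamelBack ν g s) y v‖ₑ ≤ ENNReal.ofReal B * ∫⁻ w : ℝ × (EuclideanSpace ℝ (Fin 3)), ‖g w.1 w.2‖ₑ := by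
  obtain ⟨C, hC, hG⟩ := exists_abs_heatKernelGrad_le_dim3
  refine ⟨C * (min a₀ (d₀ ^ 2)) ^ (-(2 : ℝ)), by positivity, fun {g} hg s y v hv hsee => ?_⟩
  rw [hg.fderiv_heatDuhamelBack_apply hν s y v]
  exact enorm_heatDuhamelBack_le_offDiag (P := fun a x' => a₀ ≤ a ∨ d₀ ≤ ‖x'‖)
    hν (continuousOn_heatKernelGrad_family v) hg.continuous_uncurry
    (fun ha t y => enorm_heatExtension_fderiv_le_lintegral_heatKernelGrad (hg.contDiff_slice t)
      (hg.hasCompactSupport_slice t) ha v y)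
    (fun {a} ha x' hP => by
      have h2 := add_sq_rpow_neg_le_offDiag ha₀ hd₀ (by norm_num : (0 : ℝ) ≤ 2) ha x' hP
      calc |heatKernelGrad v a x'| ≤ C * ‖v‖ * (a + ‖x'‖ ^ 2) ^ (-(2 : ℝ)) := hG ha v x'
        _ ≤ C * 1 * (a + ‖x'‖ ^ 2) ^ (-(2 : ℝ)) := by gcongr
        _ ≤ C * 1 * (min a₀ (d₀ ^ 2)) ^ (-(2 : ℝ)) :=
            mul_le_mul_of_nonneg_left h2 (by positivity)
        _ = C * (min a₀ (d₀ ^ 2)) ^ (-(2 : ℝ)) := by rw [mul_one])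
    hsee

end Heat3

/-! ### Dimension three: the Newtonian fields `Ξ = 𝒰_ν[∂_c N g]`, their derivatives, and `𝒰_ν[Λ ∂_c g]` -/

section Newton

variable {ν : ℝ} {r₀ r₁ : ℝ}

/-- **Off-diagonal bound for `heatD1 · c Γ₀`**: bounded on `{a ≥ a₀} ∪ {‖x‖ ≥ d₀}` uniformly in
`a > 0` (the collar `a ≥ a₀` by the `L¹ → L^∞` bound `norm_heatD1_le_of_le`, the annulus
`‖x‖ ≥ d₀` by the tree's `exists_abs_heatD1_newtonNear_le_of_le_norm`). [folklore] -/
theorem exists_abs_heatD1_newtonNear_le_offDiag (h₀ : 0 < r₀) (h₁ : r₀ < r₁) (c : (EuclideanSpace ℝ (Fin 3))) {a₀ d₀ : ℝ}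
    (ha₀ : 0 < a₀) (hd₀ : 0 < d₀) :
    ∃ B : ℝ, 0 ≤ B ∧ ∀ {a : ℝ}, 0 < a → ∀ x : (EuclideanSpace ℝ (Fin 3)), (a₀ ≤ a ∨ d₀ ≤ ‖x‖) →
      |heatD1 a c (newtonNear r₀ r₁) x| ≤ B := by
  set B₁ : ℝ := (4 * π * a₀) ^ (-(Module.finrank ℝ (EuclideanSpace ℝ (Fin 3)) : ℝ) / 2) * (Real.sqrt a₀)⁻¹ * ‖c‖ *
    (eLpNorm (newtonNear r₀ r₁) 1 volume).toReal with hB₁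
  have hB₁0 : 0 ≤ B₁ := by rw [hB₁]; positivity
  obtain ⟨B₂, hB₂0, hB₂⟩ := exists_abs_heatD1_newtonNear_le_of_le_norm h₀ h₁ hd₀ c
  refine ⟨max B₁ B₂, le_max_of_le_left hB₁0, fun {a} ha x hx => ?_⟩
  rcases hx with h | h
  · have h1 := norm_heatD1_le_of_le (memLp_one_newtonNear h₀ h₁) ha₀ h c x
    rw [Real.norm_eq_abs] at h1
    exact h1.trans (le_max_left _ _)
  · exact (hB₂ ha x h).trans (le_max_right _ _)

/-- **Off-diagonal bound for `heatD2 · v c Γ₀`**: bounded on `{a ≥ a₀} ∪ {‖x‖ ≥ d₀}` uniformly in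
`a > 0` (`exists_abs_heatD2_le_of_le_time` and the tree's
`exists_abs_heatD2_newtonNear_le_of_le_norm`). [folklore] -/
theorem exists_abs_heatD2_newtonNear_le_offDiag (h₀ : 0 < r₀) (h₁ : r₀ < r₁) (v c : (EuclideanSpace ℝ (Fin 3))) {a₀ d₀ : ℝ}
    (ha₀ : 0 < a₀) (hd₀ : 0 < d₀) :
    ∃ B : ℝ, 0 ≤ B ∧ ∀ {a : ℝ}, 0 < a → ∀ x : (EuclideanSpace ℝ (Fin 3)), (a₀ ≤ a ∨ d₀ ≤ ‖x‖) →
      |heatD2 a v c (newtonNear r₀ r₁) x| ≤ B := by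
  obtain ⟨B₁, hB₁0, hB₁⟩ := exists_abs_heatD2_le_of_le_time (integrable_newtonNear h₀.le h₁) v c ha₀
  obtain ⟨B₂, hB₂0, hB₂⟩ := exists_abs_heatD2_newtonNear_le_of_le_norm h₀ h₁ hd₀ v c
  refine ⟨max B₁ B₂, le_max_of_le_left hB₁0, fun {a} ha x hx => ?_⟩
  rcases hx with h | h
  · exact (hB₁ h x).trans (le_max_left _ _)
  · exact (hB₂ ha x h).trans (le_max_right _ _)

/-- **The truncated Oseen kernel on a parabolically bounded range**: from the tree's global bound
`|heatD3 a u v w Γ₀ (x)| ≤ C ((a + ‖x‖²)⁻² + 1)` (`exists_abs_heatD3_newtonNear_le`), for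
`a ≤ A`, `‖x‖ ≤ R` one has `|heatD3 a u v w Γ₀ (x)| ≤ C (1 + (A + R²)²) (a + ‖x‖²)⁻²`.
[folklore] -/
theorem exists_abs_heatD3_newtonNear_le_of_range (h₀ : 0 < r₀) (h₁ : r₀ < r₁) {A R : ℝ}
    (hA : 0 < A) (hR : 0 < R) :
    ∃ C : ℝ, 0 < C ∧ ∀ {a : ℝ}, 0 < a → ∀ (x u v w : (EuclideanSpace ℝ (Fin 3))), ‖u‖ ≤ 1 → ‖v‖ ≤ 1 → ‖w‖ ≤ 1 →
      (a ≤ A ∧ ‖x‖ ≤ R) → |heatD3 a u v w (newtonNear r₀ r₁) x| ≤ C * (a + ‖x‖ ^ 2) ^ (-(2 : ℝ)) := by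
  obtain ⟨C, hC, h⟩ := exists_abs_heatD3_newtonNear_le h₀ h₁
  refine ⟨C * (1 + (A + R ^ 2) ^ (2 : ℝ)), by positivity, fun {a} ha x u v w hu hv hw hx => ?_⟩
  set ρ : ℝ := a + ‖x‖ ^ 2 with hρ
  have hρ0 : 0 < ρ := by positivity
  have hρAR : ρ ≤ A + R ^ 2 := by rw [hρ]; nlinarith [norm_nonneg x, hx.1, hx.2]
  have hone : (1 : ℝ) ≤ (A + R ^ 2) ^ (2 : ℝ) * ρ ^ (-(2 : ℝ)) := by
    rw [Real.rpow_neg hρ0.le, ← div_eq_mul_inv, le_div_iff₀ (Real.rpow_pos_of_pos hρ0 _), one_mul]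
    exact Real.rpow_le_rpow hρ0.le hρAR (by norm_num)
  calc |heatD3 a u v w (newtonNear r₀ r₁) x| ≤ C * (ρ ^ (-(2 : ℝ)) + 1) := h ha x u v w hu hv hw
    _ ≤ C * (ρ ^ (-(2 : ℝ)) + (A + R ^ 2) ^ (2 : ℝ) * ρ ^ (-(2 : ℝ))) := by gcongr
    _ = C * (1 + (A + R ^ 2) ^ (2 : ℝ)) * ρ ^ (-(2 : ℝ)) := by ring

variable {g : ℝ → (EuclideanSpace ℝ (Fin 3)) → ℝ}

/-! #### The slice bounds -/

/-- Slice bound for `Ξ`: `‖e^{aΔ}(∂_c N h)(y)‖ₑ ≤ ∫⁻ |heatD1 a c Γ₀ (x')| ‖h(y - x')‖ₑ`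
(`h ∈ C_c^∞`). [folklore] -/
theorem enorm_heatExtension_fderiv_newtonNearPotential_le (h₀ : 0 < r₀) (h₁ : r₀ < r₁)
    {h : (EuclideanSpace ℝ (Fin 3)) → ℝ} (hh : ContDiff ℝ ((⊤ : ℕ∞) : WithTop ℕ∞) h) (hhc : HasCompactSupport h)
    {a : ℝ} (ha : 0 < a) (c y : (EuclideanSpace ℝ (Fin 3))) :
    ‖UnboundedOperators.heatExtension (fun x => fderiv ℝ (newtonNearPotential r₀ r₁ h) x c) a y‖ₑ ≤
      ∫⁻ x', ENNReal.ofReal |heatD1 a c (newtonNear r₀ r₁) x'| * ‖h (y - x')‖ₑ := by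
  rw [newtonNearPotential_eq_convolution,
    heatExtension_fderiv_convolution_eq_integral (integrable_newtonNear h₀.le h₁)
      (hasCompactSupport_newtonNear h₀.le h₁) hh hhc ha c y]
  refine (enorm_integral_le_lintegral_enorm _).trans (lintegral_mono fun x' => ?_)
  rw [enorm_mul, Real.enorm_eq_ofReal_abs]

/-- Slice bound for `∂ᵥΞ`: `‖e^{aΔ}(∂ᵥ∂_c N h)(y)‖ₑ ≤ ∫⁻ |heatD2 a v c Γ₀ (x')| ‖h(y - x')‖ₑ`.
[folklore] -/
theorem enorm_heatExtension_fderiv2_newtonNearPotential_le (h₀ : 0 < r₀) (h₁ : r₀ < r₁)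
    {h : (EuclideanSpace ℝ (Fin 3)) → ℝ} (hh : ContDiff ℝ ((⊤ : ℕ∞) : WithTop ℕ∞) h) (hhc : HasCompactSupport h)
    {a : ℝ} (ha : 0 < a) (v c y : (EuclideanSpace ℝ (Fin 3))) :
    ‖UnboundedOperators.heatExtension
        (fun x => fderiv ℝ (fun y' => fderiv ℝ (newtonNearPotential r₀ r₁ h) y' c) x v) a y‖ₑ ≤
      ∫⁻ x', ENNReal.ofReal |heatD2 a v c (newtonNear r₀ r₁) x'| * ‖h (y - x')‖ₑ := by
  simp only [newtonNearPotential_eq_convolution]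
  rw [heatExtension_fderiv_fderiv_convolution_eq_integral (integrable_newtonNear h₀.le h₁)
      (hasCompactSupport_newtonNear h₀.le h₁) hh hhc ha v c y]
  refine (enorm_integral_le_lintegral_enorm _).trans (lintegral_mono fun x' => ?_)
  rw [enorm_mul, Real.enorm_eq_ofReal_abs]

/-- Slice bound for `∂ᵤ∂ᵥΞ`:
`‖e^{aΔ}(∂ᵤ∂ᵥ∂_c N h)(y)‖ₑ ≤ ∫⁻ |heatD3 a u v c Γ₀ (x')| ‖h(y - x')‖ₑ`. [folklore] -/
theorem enorm_heatExtension_fderiv3_newtonNearPotential_le (h₀ : 0 < r₀) (h₁ : r₀ < r₁)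
    {h : (EuclideanSpace ℝ (Fin 3)) → ℝ} (hh : ContDiff ℝ ((⊤ : ℕ∞) : WithTop ℕ∞) h) (hhc : HasCompactSupport h)
    {a : ℝ} (ha : 0 < a) (u v c y : (EuclideanSpace ℝ (Fin 3))) :
    ‖UnboundedOperators.heatExtension
        (fun x => fderiv ℝ (fun z => fderiv ℝ (fun y' =>
          fderiv ℝ (newtonNearPotential r₀ r₁ h) y' c) z v) x u) a y‖ₑ ≤
      ∫⁻ x', ENNReal.ofReal |heatD3 a u v c (newtonNear r₀ r₁) x'| * ‖h (y - x')‖ₑ := by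
  simp only [newtonNearPotential_eq_convolution]
  rw [heatExtension_fderiv3_convolution_eq_integral (integrable_newtonNear h₀.le h₁)
      (hasCompactSupport_newtonNear h₀.le h₁) hh hhc ha u v c y]
  refine (enorm_integral_le_lintegral_enorm _).trans (lintegral_mono fun x' => ?_)
  rw [enorm_mul, Real.enorm_eq_ofReal_abs]

/-- Slice bound for `𝒰_ν[Λ ∂_c g]`: `‖e^{aΔ}(Λ[∂_c h])(y)‖ₑ ≤ ∫⁻ |heatD1 a c λ (x')| ‖h(y - x')‖ₑ`
(`Λ[∂_c h] = ∂_c(λ ⋆ h)`). [folklore] -/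
theorem enorm_heatExtension_newtonFarSmoothing_fderiv_le (h₀ : 0 < r₀) (h₁ : r₀ < r₁)
    {h : (EuclideanSpace ℝ (Fin 3)) → ℝ} (hh : ContDiff ℝ ((⊤ : ℕ∞) : WithTop ℕ∞) h) (hhc : HasCompactSupport h)
    {a : ℝ} (ha : 0 < a) (c y : (EuclideanSpace ℝ (Fin 3))) :
    ‖UnboundedOperators.heatExtension
        (fun x => newtonFarSmoothing r₀ r₁ (fun y' => fderiv ℝ h y' c) x) a y‖ₑ ≤
      ∫⁻ x', ENNReal.ofReal |heatD1 a c (newtonFarLaplacian r₀ r₁) x'| * ‖h (y - x')‖ₑ := by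
  have h1 : (fun x => newtonFarSmoothing r₀ r₁ (fun y' => fderiv ℝ h y' c) x) =
      fun x => fderiv ℝ (newtonFarLaplacian r₀ r₁ ⋆[lsmul ℝ ℝ, (volume : Measure (EuclideanSpace ℝ (Fin 3)))] h) x c := by
    funext x
    rw [← newtonFarSmoothing_eq_convolution,
      fderiv_newtonFarSmoothing_apply h₀ h₁ (hh.of_le (by exact_mod_cast le_top))]
  rw [h1, heatExtension_fderiv_convolution_eq_integral (integrable_newtonFarLaplacian h₀ h₁)
    (hasCompactSupport_newtonFarLaplacian h₀.le h₁) hh hhc ha c y]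
  refine (enorm_integral_le_lintegral_enorm _).trans (lintegral_mono fun x' => ?_)
  rw [enorm_mul, Real.enorm_eq_ofReal_abs]

/-! #### The second derivatives of `Ξ` as a single Duhamel integral -/

/-- `∂ᵤ∂ᵥ 𝒰_ν[∂_c N g](s) = 𝒰_ν[∂ᵤ∂ᵥ∂_c N g](s)` (two derivatives fall on the data).
[folklore] -/
theorem fderiv_fderiv_heatDuhamelBack_fderiv_newtonNearPotential
    (hg : IsSpaceTimeTestOn (⊤ : Opens (ℝ × (EuclideanSpace ℝ (Fin 3)))) g) (h₀ : 0 < r₀) (h₁ : r₀ < r₁) (hν : 0 < ν)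
    (u v c : (EuclideanSpace ℝ (Fin 3))) (s : ℝ) (y : (EuclideanSpace ℝ (Fin 3))) :
    fderiv ℝ (fun x' => fderiv ℝ
      (heatDuhamelBack ν (fun t y => fderiv ℝ (newtonNearPotential r₀ r₁ (g t)) y c) s) x' v) y u =
      heatDuhamelBack ν (fun t y => fderiv ℝ (fun z => fderiv ℝ (fun y' =>
        fderiv ℝ (newtonNearPotential r₀ r₁ (g t)) y' c) z v) y u) s y := by
  have hΘ := isSpaceTimeTestOn_fderiv_newtonNearPotential_top hg h₀ h₁ c
  have step1 : (fun x' => fderiv ℝ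
      (heatDuhamelBack ν (fun t y => fderiv ℝ (newtonNearPotential r₀ r₁ (g t)) y c) s) x' v) =
      heatDuhamelBack ν (fun t y => fderiv ℝ (fun y' =>
        fderiv ℝ (newtonNearPotential r₀ r₁ (g t)) y' c) y v) s :=
    funext fun x' => hΘ.fderiv_heatDuhamelBack_apply hν s x' v
  rw [step1, (hΘ.fderiv_apply_top v).fderiv_heatDuhamelBack_apply hν s y u]

/-! #### Parabolic bound for `∂ᵤ∂ᵥΞ` -/

/-- **`|∂ᵤ∂ᵥΞ(s,y)| ≤ C ∫∫ δ₂^{-4} |g|`** (Lemarié-Rieusset 2016, (13.52): the pressure term is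
dominated by `𝓘₁(φ|uⱼuₗ|)`, the kernel of `e^{νtΔ}∇∂ⱼ∂ₗΔ⁻¹` being `O(δ₂⁻⁴)`): for `ν, r₀ < r₁`,
`A, R > 0` there is `C` such that, for every test function `g`, all `‖u‖,‖v‖,‖c‖ ≤ 1` and every
`(s, y)` from which the support of `g` is seen at heat times `ν(t-s) ≤ A` and distances
`‖y - x‖ ≤ R`, the second derivatives of `Ξ = 𝒰_ν[∂_c N g]` satisfy the displayed bound.
[cite: LemarieRieusset2016, §13.9 Step 3 (13.52) p. 475] -/
theorem exists_enorm_fderiv2_heatDuhamelBack_newton_le_parabolic (h₀ : 0 < r₀) (h₁ : r₀ < r₁)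
    (hν : 0 < ν) {A R : ℝ} (hA : 0 < A) (hR : 0 < R) :
    ∃ C : ℝ, 0 < C ∧ ∀ {g : ℝ → (EuclideanSpace ℝ (Fin 3)) → ℝ}, IsSpaceTimeTestOn (⊤ : Opens (ℝ × (EuclideanSpace ℝ (Fin 3)))) g →
      ∀ (u v c : (EuclideanSpace ℝ (Fin 3))), ‖u‖ ≤ 1 → ‖v‖ ≤ 1 → ‖c‖ ≤ 1 → ∀ (s : ℝ) (y : (EuclideanSpace ℝ (Fin 3))),
        (∀ t x, g t x ≠ 0 → s < t → ν * (t - s) ≤ A ∧ ‖y - x‖ ≤ R) →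
        ‖fderiv ℝ (fun x' => fderiv ℝ
            (heatDuhamelBack ν (fun t y => fderiv ℝ (newtonNearPotential r₀ r₁ (g t)) y c) s) x' v)
            y u‖ₑ ≤
          ENNReal.ofReal C *
            ∫⁻ w : ℝ × (EuclideanSpace ℝ (Fin 3)), (ENNReal.ofReal (parabolicDist (s, y) w) ^ (4 : ℝ))⁻¹ * ‖g w.1 w.2‖ₑ := by
  obtain ⟨C, hC, hK⟩ := exists_abs_heatD3_newtonNear_le_of_range h₀ h₁ hA hR
  refine ⟨C * (min ν 1 / 2) ^ (-(2 : ℝ)), by positivity,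
    fun {g} hg u v c hu hv hc s y hsee => ?_⟩
  rw [fderiv_fderiv_heatDuhamelBack_fderiv_newtonNearPotential hg h₀ h₁ hν u v c s y]
  have h := enorm_heatDuhamelBack_le_parabolic (P := fun a x' => a ≤ A ∧ ‖x'‖ ≤ R) hν
    (continuousOn_uncurry_heatD3 (memLp_one_newtonNear h₀ h₁) u v c) hg.continuous_uncurry
    (fun ha t y => enorm_heatExtension_fderiv3_newtonNearPotential_le h₀ h₁ (hg.contDiff_slice t)
      (hg.hasCompactSupport_slice t) ha u v c y)
    hC.le (by norm_num : (0 : ℝ) < 2) (C := C) (s := s) (y := y)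
    (fun {a} ha x' hP => hK ha x' u v c hu hv hc hP) hsee
  rwa [show (2 * (2 : ℝ)) = 4 by norm_num] at h

/-! #### Off-diagonal bounds for `Ξ` and `∂ᵥΞ`, and the bound for `𝒰_ν[Λ ∂_c g]` -/

/-- **Off-diagonal bound for `Ξ = 𝒰_ν[∂_c N g]`**: `|Ξ(s,y)| ≤ B ∫∫ |g|` whenever from `(s, y)`
the support of `g` is only seen at heat times `≥ a₀` or distances `≥ d₀`. [folklore] -/
theorem exists_enorm_heatDuhamelBack_newton_le_offDiag (h₀ : 0 < r₀) (h₁ : r₀ < r₁)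
    (hν : 0 < ν) (c : (EuclideanSpace ℝ (Fin 3))) {a₀ d₀ : ℝ} (ha₀ : 0 < a₀) (hd₀ : 0 < d₀) :
    ∃ B : ℝ, 0 ≤ B ∧ ∀ {g : ℝ → (EuclideanSpace ℝ (Fin 3)) → ℝ}, IsSpaceTimeTestOn (⊤ : Opens (ℝ × (EuclideanSpace ℝ (Fin 3)))) g →
      ∀ (s : ℝ) (y : (EuclideanSpace ℝ (Fin 3))),
        (∀ t x, g t x ≠ 0 → s < t → a₀ ≤ ν * (t - s) ∨ d₀ ≤ ‖y - x‖) →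
        ‖heatDuhamelBack ν (fun t y => fderiv ℝ (newtonNearPotential r₀ r₁ (g t)) y c) s y‖ₑ ≤
          ENNReal.ofReal B * ∫⁻ w : ℝ × (EuclideanSpace ℝ (Fin 3)), ‖g w.1 w.2‖ₑ := by
  obtain ⟨B, hB0, hB⟩ := exists_abs_heatD1_newtonNear_le_offDiag h₀ h₁ c ha₀ hd₀
  refine ⟨B, hB0, fun {g} hg s y hsee => ?_⟩
  exact enorm_heatDuhamelBack_le_offDiag (P := fun a x' => a₀ ≤ a ∨ d₀ ≤ ‖x'‖) hν
    (continuousOn_heatD1_family (memLp_one_newtonNear h₀ h₁) c) hg.continuous_uncurry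
    (fun ha t y => enorm_heatExtension_fderiv_newtonNearPotential_le h₀ h₁ (hg.contDiff_slice t)
      (hg.hasCompactSupport_slice t) ha c y)
    (fun ha x' hP => hB ha x' hP) hsee

/-- **Off-diagonal bound for `∂ᵥΞ`**: `|∂ᵥΞ(s,y)| ≤ B ∫∫ |g|` under the same separation.
[folklore] -/
theorem exists_enorm_fderiv_heatDuhamelBack_newton_le_offDiag (h₀ : 0 < r₀) (h₁ : r₀ < r₁)
    (hν : 0 < ν) (v c : (EuclideanSpace ℝ (Fin 3))) {a₀ d₀ : ℝ} (ha₀ : 0 < a₀) (hd₀ : 0 < d₀) :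
    ∃ B : ℝ, 0 ≤ B ∧ ∀ {g : ℝ → (EuclideanSpace ℝ (Fin 3)) → ℝ}, IsSpaceTimeTestOn (⊤ : Opens (ℝ × (EuclideanSpace ℝ (Fin 3)))) g →
      ∀ (s : ℝ) (y : (EuclideanSpace ℝ (Fin 3))),
        (∀ t x, g t x ≠ 0 → s < t → a₀ ≤ ν * (t - s) ∨ d₀ ≤ ‖y - x‖) →
        ‖fderiv ℝ (heatDuhamelBack ν
            (fun t y => fderiv ℝ (newtonNearPotential r₀ r₁ (g t)) y c) s) y v‖ₑ ≤
          ENNReal.ofReal B * ∫⁻ w : ℝ × (EuclideanSpace ℝ (Fin 3)), ‖g w.1 w.2‖ₑ := by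
  obtain ⟨B, hB0, hB⟩ := exists_abs_heatD2_newtonNear_le_offDiag h₀ h₁ v c ha₀ hd₀
  refine ⟨B, hB0, fun {g} hg s y hsee => ?_⟩
  have hΘ := isSpaceTimeTestOn_fderiv_newtonNearPotential_top hg h₀ h₁ c
  rw [hΘ.fderiv_heatDuhamelBack_apply hν s y v]
  exact enorm_heatDuhamelBack_le_offDiag (P := fun a x' => a₀ ≤ a ∨ d₀ ≤ ‖x'‖) hν
    (continuousOn_uncurry_heatD2 (memLp_one_newtonNear h₀ h₁) v c) hg.continuous_uncurry
    (fun ha t y => enorm_heatExtension_fderiv2_newtonNearPotential_le h₀ h₁ (hg.contDiff_slice t)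
      (hg.hasCompactSupport_slice t) ha v c y)
    (fun ha x' hP => hB ha x' hP) hsee

/-- **`𝒰_ν[Λ ∂_c g]` is bounded by `B ∫∫ |g|` everywhere** (its kernel `heatD1 a c λ` is bounded,
`λ` being smooth and compactly supported). [folklore] -/
theorem exists_enorm_heatDuhamelBack_farSmoothing_le (h₀ : 0 < r₀) (h₁ : r₀ < r₁) (hν : 0 < ν)
    (c : (EuclideanSpace ℝ (Fin 3))) :
    ∃ B : ℝ, 0 ≤ B ∧ ∀ {g : ℝ → (EuclideanSpace ℝ (Fin 3)) → ℝ}, IsSpaceTimeTestOn (⊤ : Opens (ℝ × (EuclideanSpace ℝ (Fin 3)))) g →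
      ∀ (s : ℝ) (y : (EuclideanSpace ℝ (Fin 3))),
        ‖heatDuhamelBack ν
            (fun t y => newtonFarSmoothing r₀ r₁ (fun y' => fderiv ℝ (g t) y' c) y) s y‖ₑ ≤
          ENNReal.ofReal B * ∫⁻ w : ℝ × (EuclideanSpace ℝ (Fin 3)), ‖g w.1 w.2‖ₑ := by
  obtain ⟨B, hB0, hB⟩ := exists_abs_heatD1_newtonFarLaplacian_le h₀ h₁ c
  refine ⟨B, hB0, fun {g} hg s y => ?_⟩
  exact enorm_heatDuhamelBack_le_offDiag (P := fun _ _ => True) hν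
    (continuousOn_heatD1_family (memLp_one_newtonFarLaplacian h₀ h₁) c) hg.continuous_uncurry
    (fun ha t y => enorm_heatExtension_newtonFarSmoothing_fderiv_le h₀ h₁ (hg.contDiff_slice t)
      (hg.hasCompactSupport_slice t) ha c y)
    (fun ha x' _ => hB ha x') (fun _ _ _ _ => trivial)

/-! #### The Laplacian of `Ξ` for every viscosity -/

/-- **`ΔΞ(s, ·)(x) = ∂_c 𝒰_ν[g](s, x) - 𝒰_ν[Λ ∂_c g](s, x)`** for `Ξ = 𝒰_ν[∂_c N g]` and every
`ν > 0` (`Δ` through `𝒰_ν`, `∂_c N[h] = N[∂_c h]`, `ΔN[h] = h - Λ[h]`; the tree's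
`laplacian_heatDuhamelBack_fderiv_newtonNearPotential` is the case `ν = 1`). [folklore] -/
theorem laplacian_heatDuhamelBack_fderiv_newtonNearPotential_nu
    (hg : IsSpaceTimeTestOn (⊤ : Opens (ℝ × (EuclideanSpace ℝ (Fin 3)))) g) (h₀ : 0 < r₀) (h₁ : r₀ < r₁) (hν : 0 < ν)
    (c : (EuclideanSpace ℝ (Fin 3))) (s : ℝ) (x : (EuclideanSpace ℝ (Fin 3))) :
    (Δ (heatDuhamelBack ν (fun t y => fderiv ℝ (newtonNearPotential r₀ r₁ (g t)) y c) s)) x =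
      fderiv ℝ (heatDuhamelBack ν g s) x c -
        heatDuhamelBack ν (fun t y => newtonFarSmoothing r₀ r₁ (fun y' => fderiv ℝ (g t) y' c) y)
          s x := by
  have hΘ := isSpaceTimeTestOn_fderiv_newtonNearPotential_top hg h₀ h₁ c
  have hgc : IsSpaceTimeTestOn (⊤ : Opens (ℝ × (EuclideanSpace ℝ (Fin 3)))) (fun t y => fderiv ℝ (g t) y c) :=
    hg.fderiv_apply_top c
  have hΛ := isSpaceTimeTestOn_newtonFarSmoothing_top hgc h₀ h₁
  rw [hΘ.laplacian_heatDuhamelBack hν s x, hg.fderiv_heatDuhamelBack_apply hν s x c,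
    ← heatDuhamelBack_sub hgc hΛ hν s x]
  congr 1
  funext t y
  have h1 : (fun y' => fderiv ℝ (newtonNearPotential r₀ r₁ (g t)) y' c) =
      newtonNearPotential r₀ r₁ (fun w => fderiv ℝ (g t) w c) :=
    funext fun y' => fderiv_newtonNearPotential_apply h₀.le h₁
      ((hg.contDiff_slice t).of_le (by exact_mod_cast le_top)) y' c
  have h2 : ContDiff ℝ 2 (fun w => fderiv ℝ (g t) w c) :=
    (hgc.contDiff_slice t).of_le (by
      change ((2 : ℕ∞) : WithTop ℕ∞) ≤ ((⊤ : ℕ∞) : WithTop ℕ∞); exact_mod_cast le_top)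
  rw [h1, laplacian_newtonNearPotential h₀ h₁ h2]

end Newton

end Literature.Analysis.FluidPDE
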